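import Summits.CriticalPhenomena.PercolationContinuityZ3.Theorems.PercNearOneGluingNoHeavyConstsLinearLowerTailStarCount
import Summits.CriticalPhenomena.PercolationContinuityZ3.Theorems.PercNearOneGluingNoHeavyConstsLinearLowerTailAnyObserver
import HarnessLib

/-!
# (LT³⁄₂) on all stars: `P(1 ≤ N < κ·EN) ≤ (3/2)·s` for every star, every weight, every relay set, every observer, every `κ ≤ 2/3`

builds on p205010 (kernel theorem, internal audit signed; external expert review pending)

PAPER-2 track "percolation constants", part (ii), seat `prim-consts-1`, gen 9 (lane index `run/shared/lean/prim/consts/CONSTANTS.md`,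
row A19; memo `FROM-prim-consts-1-g8-ROOTED-SPLIT.md` §6b step (vi)).  Support file for the crux `NoHeavyLowerTail`
(stmt-CriticalPhenomena-4575; `--supports … --as helper`): theorems only, no definitions, no sorries, standard axioms.

THE RESULT.  `Consts.linearLowerTailThreeHalves_star`: the conjecture (LT³⁄₂) `Consts.LinearLowerTailThreeHalves` (for every
`0 < κ ≤ 2/3` and every finite weighted graph, `P(1 ≤ N < κ·EN) ≤ (3/2)·s` whenever all relay pairs have `P(a ↮ a') ≤ s`) HOLDS on
the whole class of STARS: weights `w` with `w e = 0` unless the hub `h ∈ e`, any number of vertices, arbitrary spoke weights, arbitrary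
relay set `A` (the hub may or may not be a relay point), arbitrary observer `o` (hub, relay leaf, or non-relay leaf).  Stars are the
diffuse extreme of the relay-set spectrum (many independent single cuts); the other extreme, `|A| ≤ 6`, and every `κ|A| ≤ 4` are
KERNEL since gen 5 (`…ConstsLinearLowerTailAnyObserver`), and the hub-leaf gadgets showing that `3/2` is optimal are stars with glued
groups (`…ConstsLinearLowerTailHubLeaf`).
THE PROOF (wrapper around the probability cores).  Off the null event "some weight-0 edge is open" the cluster of the observer is read
off the spokes (`…ConstsLinearLowerTailStarCore`).  `|A| ≤ 6` is kernel, so `K ≥ 5` relay leaves remain besides hub and observer.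
* Observer = hub (`Consts.real_lowerTail_le_three_halves_star_hub`): `N = 1[h∈A] + K − L` with `L` the number of closed relay spokes,
  `EN ≤ 1[h∈A] + K − S`, so `N < κEN ≤ (2/3)(…)` forces `L > K/3 + 2S/3`; pairs of relay leaves give `(1−p_a)+(1−p_a')−(1−p_a)(1−p_a') ≤ s`;
  conclude by `Consts.prodBernoulli_real_closedCount_ge_le_three_halves`.
* Observer = leaf `ℓ` (`Consts.real_lowerTail_le_three_halves_star_leaf`): if `ℓ ∉ A`, `1 ≤ N` forces the spoke of `ℓ` open and then
  `N = 1[h∈A] + K − L` as before; if `ℓ ∈ A`, the bad event lies in `{spoke ℓ closed} ∪ ({spoke ℓ open} ∩ {L ≥ t⁺})` with the SHARPENED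
  threshold `t⁺ > K/3 + 2S/3 + 1/3`, of probability `q_ℓ + (1 − q_ℓ)P(L ≥ t⁺)` by independence of disjoint supports, and the pairs
  `(ℓ, a)` give `q_ℓ + (1 − q_ℓ)x ≤ s`; conclude by `Consts.prodBernoulli_real_closedCount_ge_le_three_halves_leaf`.
References: G. Kozma, N. Nitzan, arXiv:2401.12397 (2024), Conj. 1 (p. 3); G. Grimmett, *Percolation* (1999), §1.3, §2.2.
-/

noncomputable section

namespace Summit.CriticalPhenomena.PercolationContinuityZ3.Theorems

open MeasureTheory Set Literature.Probability.LatticeModels Literature.Probability.Percolation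
open scoped Classical

namespace Consts

/-! ### Observer at the hub -/

/-- **(LT³⁄₂) on stars, observer at the hub.**  `w` with star support at `h`, any relay set `A`, observer `o = h`, any `0 < κ ≤ 2/3`,
any `s ≥ 0` bounding all relay pairs: `P(1 ≤ N < κ·EN) ≤ (3/2)·s`. [cite: KozmaNitzan2024, Conj. 1 (p. 3)] -/
theorem real_lowerTail_le_three_halves_star_hub (n : ℕ) (w : Sym2 (Fin n) → unitInterval) (h : Fin n)
    (hw : ∀ e, h ∉ e → w e = 0) (A : Finset (Fin n)) {κ s : ℝ} (hκ0 : 0 < κ) (hκ : κ ≤ 2 / 3) (hs : 0 ≤ s)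
    (hrel : ∀ a ∈ A, ∀ a' ∈ A, (prodBernoulli w).real (openConn a a')ᶜ ≤ s) :
    (prodBernoulli w).real {ω : BondConfig (Fin n) | 1 ≤ (A.filter fun a => ω ∈ openConn h a).card ∧
        ((A.filter fun a => ω ∈ openConn h a).card : ℝ) < κ * (∑ a ∈ A, (prodBernoulli w).real (openConn h a))} ≤
      3 / 2 * s := by
  by_cases hA6 : A.card ≤ 6
  · exact real_lowerTail_le_three_halves_of_card_le_six_any n w A h hA6 hκ0 hκ hs hrel
  set A' : Finset (Fin n) := A.erase h with hA'
  have hK5 : 5 ≤ A'.card := le_trans (by omega) (Finset.pred_card_le_card_erase)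
  set F : Finset (Sym2 (Fin n)) := A'.image fun a => s(h, a) with hF
  obtain ⟨hFcard, hFsum, hFfilter⟩ := Star.spokes_image w h A'
  set K : ℕ := A'.card with hKdef
  set S : ℝ := ∑ a ∈ A', (1 - (w s(h, a) : ℝ)) with hSdef
  have hpair := Star.spokes_pair_budget hw (A := A) (A₀ := A') (Finset.erase_subset h A) (Finset.notMem_erase h A) hrel
  -- the threshold
  set r : ℝ := (K : ℝ) / 3 + 2 * S / 3 with hr
  have hS0 : 0 ≤ S := Finset.sum_nonneg fun a _ => sub_nonneg.2 (w s(h, a)).2.2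
  have hr0 : 0 ≤ r := by positivity
  set t : ℕ := ⌊r⌋₊ + 1 with ht
  have htR : (t : ℝ) = ⌊r⌋₊ + 1 := by rw [ht]; push_cast; ring
  have ht1 : r < t := by rw [htR]; exact Nat.lt_floor_add_one r
  have ht2 : (t : ℝ) ≤ r + 1 := by rw [htR]; linarith [Nat.floor_le hr0]
  have hcore := prodBernoulli_real_closedCount_ge_le_three_halves w F (by rw [hFcard]; exact hK5) hs hpair (t := t)
    (by rw [hFcard, hFsum]; linarith [ht1]) (by rw [hFcard, hFsum]; linarith [ht2])
  -- containment off the null event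
  refine (measureReal_le_of_inter_compl_subset (SpiderGluing.real_exists_zero_open w) ?_).trans hcore
  rintro ω ⟨⟨-, hlt⟩, hz⟩
  have hω : ∀ e, w e = 0 → e ∉ ω := fun e he heω => hz ⟨e, he, heω⟩
  simp only [Set.mem_setOf_eq]
  rw [hFfilter ω]
  have hN := Star.card_filter_openConn_hub hw hω A
  have hsplit : (((A'.filter fun a => s(h, a) ∈ ω).card : ℝ)) + ((A'.filter fun a => s(h, a) ∉ ω).card : ℝ) = K := by
    exact_mod_cast Finset.card_filter_add_card_filter_not (s := A') (fun a => s(h, a) ∈ ω)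
  have hEN := Star.sum_real_openConn_hub_le hw A
  have hpS : ∑ a ∈ A', (w s(h, a) : ℝ) = K - S := by
    rw [hSdef, Finset.sum_sub_distrib, Finset.sum_const, nsmul_eq_mul, mul_one]; ring
  rw [hpS] at hEN
  have hI : (0 : ℝ) ≤ (if h ∈ A then (1 : ℝ) else 0) ∧ (if h ∈ A then (1 : ℝ) else 0) ≤ 1 := by
    split_ifs <;> norm_num
  have hEN0 : 0 ≤ ∑ a ∈ A, (prodBernoulli w).real (openConn h a) := Finset.sum_nonneg fun a _ => measureReal_nonneg
  have hSK : S ≤ K := by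
    have : (0 : ℝ) ≤ ∑ a ∈ A', (w s(h, a) : ℝ) := Finset.sum_nonneg fun a _ => (w s(h, a)).2.1
    linarith
  -- N = I + (K - L) < κ EN ≤ (2/3)(I + K - S)  ⟹  L > K/3 + 2S/3
  have hL : r < ((A'.filter fun a => s(h, a) ∉ ω).card : ℝ) := by
    rw [hN] at hlt
    have h23 : κ * (∑ a ∈ A, (prodBernoulli w).real (openConn h a)) ≤ 2 / 3 * ((if h ∈ A then (1 : ℝ) else 0) + (K - S)) := by
      calc κ * (∑ a ∈ A, (prodBernoulli w).real (openConn h a)) ≤ κ * ((if h ∈ A then (1 : ℝ) else 0) + (K - S)) :=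
            mul_le_mul_of_nonneg_left hEN hκ0.le
        _ ≤ 2 / 3 * ((if h ∈ A then (1 : ℝ) else 0) + (K - S)) := mul_le_mul_of_nonneg_right hκ (by linarith [hI.1])
    rw [hr]; linarith [hI.1, hI.2]
  have hfl : ⌊r⌋₊ < (A'.filter fun a => s(h, a) ∉ ω).card := (Nat.floor_lt hr0).2 hL
  omega


/-! ### Observer at a leaf -/

/-- **(LT³⁄₂) on stars, observer at a leaf.**  `w` with star support at `h`, any relay set `A`, observer `ℓ ≠ h` (in `A` or not), any
`0 < κ ≤ 2/3`, any `s ≥ 0` bounding all relay pairs: `P(1 ≤ N < κ·EN) ≤ (3/2)·s`. [cite: KozmaNitzan2024, Conj. 1 (p. 3)] -/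
theorem real_lowerTail_le_three_halves_star_leaf (n : ℕ) (w : Sym2 (Fin n) → unitInterval) (h : Fin n)
    (hw : ∀ e, h ∉ e → w e = 0) (A : Finset (Fin n)) {ℓ : Fin n} (hℓ : ℓ ≠ h) {κ s : ℝ} (hκ0 : 0 < κ) (hκ : κ ≤ 2 / 3)
    (hs : 0 ≤ s) (hrel : ∀ a ∈ A, ∀ a' ∈ A, (prodBernoulli w).real (openConn a a')ᶜ ≤ s) :
    (prodBernoulli w).real {ω : BondConfig (Fin n) | 1 ≤ (A.filter fun a => ω ∈ openConn ℓ a).card ∧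
        ((A.filter fun a => ω ∈ openConn ℓ a).card : ℝ) < κ * (∑ a ∈ A, (prodBernoulli w).real (openConn ℓ a))} ≤
      3 / 2 * s := by
  by_cases hA6 : A.card ≤ 6
  · exact real_lowerTail_le_three_halves_of_card_le_six_any n w A ℓ hA6 hκ0 hκ hs hrel
  -- the relay leaves other than the observer, their spokes `F`, their number `K` and total closing probability `S`
  set A'' : Finset (Fin n) := (A.erase ℓ).erase h with hA''
  have hK5 : 5 ≤ A''.card :=
    le_trans (le_trans (by omega) (Nat.sub_le_sub_right (Finset.pred_card_le_card_erase (s := A) (a := ℓ)) 1))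
      Finset.pred_card_le_card_erase
  have hA''A : A'' ⊆ A := (Finset.erase_subset h _).trans (Finset.erase_subset ℓ A)
  obtain ⟨F, hF⟩ : ∃ F : Finset (Sym2 (Fin n)), F = A''.image fun a => s(h, a) := ⟨_, rfl⟩
  obtain ⟨S, hSdef⟩ : ∃ S : ℝ, S = ∑ a ∈ A'', (1 - (w s(h, a) : ℝ)) := ⟨_, rfl⟩
  have hFcard : F.card = A''.card := by rw [hF]; exact (Star.spokes_image w h A'').1
  have hFsum : ∑ e ∈ F, (1 - (w e : ℝ)) = S := by rw [hF, hSdef]; exact (Star.spokes_image w h A'').2.1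
  have hFfilter : ∀ ω : BondConfig (Fin n), (F.filter fun e => e ∉ ω).card = (A''.filter fun a => s(h, a) ∉ ω).card := by
    intro ω; rw [hF]; exact (Star.spokes_image w h A'').2.2 ω
  have hpair : ∀ e ∈ F, ∀ e' ∈ F, e ≠ e' → (1 - (w e : ℝ)) + (1 - w e') - (1 - w e) * (1 - w e') ≤ s := by
    rw [hF]; exact Star.spokes_pair_budget hw hA''A (Finset.notMem_erase h _) hrel
  have hF5 : 5 ≤ F.card := by rw [hFcard]; exact hK5
  have hK0 : (0 : ℝ) < A''.card := by exact_mod_cast (show 0 < A''.card by omega)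
  have hS0 : 0 ≤ S := by rw [hSdef]; exact Finset.sum_nonneg fun a _ => sub_nonneg.2 (w s(h, a)).2.2
  have hpS : ∑ a ∈ A'', (w s(h, a) : ℝ) = A''.card - S := by
    rw [hSdef, Finset.sum_sub_distrib, Finset.sum_const, nsmul_eq_mul, mul_one]; ring
  -- `EN ≤ 1[ℓ ∈ A] + 1[h ∈ A] + (K - S)` and `κ·EN ≤ (2/3)·(…)`
  have hEN := Star.sum_real_openConn_leaf_le hw hℓ A
  rw [hpS] at hEN
  have hIℓ : (0 : ℝ) ≤ (if ℓ ∈ A then (1 : ℝ) else 0) ∧ (if ℓ ∈ A then (1 : ℝ) else 0) ≤ 1 := by split_ifs <;> norm_num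
  have hIh : (0 : ℝ) ≤ (if h ∈ A then (1 : ℝ) else 0) ∧ (if h ∈ A then (1 : ℝ) else 0) ≤ 1 := by split_ifs <;> norm_num
  have hSK : S ≤ A''.card := by
    have : (0 : ℝ) ≤ ∑ a ∈ A'', (w s(h, a) : ℝ) := Finset.sum_nonneg fun a _ => (w s(h, a)).2.1
    linarith
  have h23 : κ * (∑ a ∈ A, (prodBernoulli w).real (openConn ℓ a)) ≤
      2 / 3 * ((if ℓ ∈ A then (1 : ℝ) else 0) + (if h ∈ A then (1 : ℝ) else 0) + (A''.card - S)) :=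
    calc κ * (∑ a ∈ A, (prodBernoulli w).real (openConn ℓ a))
        ≤ κ * ((if ℓ ∈ A then (1 : ℝ) else 0) + (if h ∈ A then (1 : ℝ) else 0) + (A''.card - S)) :=
          mul_le_mul_of_nonneg_left hEN hκ0.le
      _ ≤ 2 / 3 * ((if ℓ ∈ A then (1 : ℝ) else 0) + (if h ∈ A then (1 : ℝ) else 0) + (A''.card - S)) :=
          mul_le_mul_of_nonneg_right hκ (by linarith [hIℓ.1, hIh.1])
  have hsplit : ∀ ω : BondConfig (Fin n),
      (((A''.filter fun a => s(h, a) ∈ ω).card : ℝ)) + ((A''.filter fun a => s(h, a) ∉ ω).card : ℝ) = A''.card := fun ω => by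
    exact_mod_cast Finset.card_filter_add_card_filter_not (s := A'') (fun a => s(h, a) ∈ ω)
  by_cases hℓA : ℓ ∈ A
  · -- observer is a relay leaf: sharpened threshold `t > K/3 + 2S/3 + 1/3`
    rw [if_pos hℓA] at h23
    obtain ⟨r, hr⟩ : ∃ r : ℝ, r = (A''.card : ℝ) / 3 + 2 * S / 3 + 1 / 3 := ⟨_, rfl⟩
    have hr0 : 0 ≤ r := by rw [hr]; linarith only [hS0, hK0]
    obtain ⟨t, ht⟩ : ∃ t : ℕ, t = ⌊r⌋₊ + 1 := ⟨_, rfl⟩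
    have htR : (t : ℝ) = ⌊r⌋₊ + 1 := by rw [ht]; push_cast; ring
    have ht1 : (F.card : ℝ) / 3 + 2 * (∑ e ∈ F, (1 - (w e : ℝ))) / 3 + 1 / 3 < t := by
      rw [hFcard, hFsum, htR, ← hr]; exact Nat.lt_floor_add_one r
    have ht2 : (t : ℝ) ≤ (F.card : ℝ) / 3 + 2 * (∑ e ∈ F, (1 - (w e : ℝ))) / 3 + 4 / 3 := by
      rw [hFcard, hFsum, htR]
      linarith only [Nat.floor_le hr0, hr]
    -- the budget `q + (1 - q)·S/K ≤ s` from the pairs `(ℓ, a)`, `a ∈ A''`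
    have hq0 : (0 : ℝ) ≤ 1 - (w s(h, ℓ) : ℝ) := sub_nonneg.2 (w s(h, ℓ)).2.2
    have hq1 : 1 - (w s(h, ℓ) : ℝ) ≤ 1 := by linarith [(w s(h, ℓ)).2.1]
    have hqs : (1 - (w s(h, ℓ) : ℝ)) + (1 - (1 - (w s(h, ℓ) : ℝ))) * ((∑ e ∈ F, (1 - (w e : ℝ))) / F.card) ≤ s := by
      rw [hFsum, hFcard]
      have hsum : ∑ a ∈ A'', ((1 - (w s(h, ℓ) : ℝ)) + (w s(h, ℓ) : ℝ) * (1 - (w s(h, a) : ℝ))) ≤ ∑ a ∈ A'', s := by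
        refine Finset.sum_le_sum fun a ha => ?_
        have hah : a ≠ h := Finset.ne_of_mem_erase ha
        have haℓ : a ≠ ℓ := Finset.ne_of_mem_erase (Finset.mem_of_mem_erase ha)
        have hle := Star.real_openConn_leaf_leaf_le hw hℓ hah (Ne.symm haℓ)
        have hcompl : (prodBernoulli w).real (openConn ℓ a)ᶜ = 1 - (prodBernoulli w).real (openConn ℓ a) :=
          probReal_compl_eq_one_sub MeasurableSet.of_discrete
        have hs1 := hrel ℓ hℓA a (hA''A ha)
        rw [hcompl] at hs1
        have e0 : (1 - (w s(h, ℓ) : ℝ)) + (w s(h, ℓ) : ℝ) * (1 - (w s(h, a) : ℝ)) = 1 - (w s(h, ℓ) : ℝ) * w s(h, a) := by ring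
        linarith only [hs1, hle, e0]
      rw [Finset.sum_add_distrib, Finset.sum_const, Finset.sum_const, nsmul_eq_mul, nsmul_eq_mul, ← Finset.mul_sum, ← hSdef]
        at hsum
      have e1 : ((A''.card : ℝ) * (1 - (w s(h, ℓ) : ℝ)) + (w s(h, ℓ) : ℝ) * S) / A''.card =
          (1 - (w s(h, ℓ) : ℝ)) + (1 - (1 - (w s(h, ℓ) : ℝ))) * (S / A''.card) := by
        rw [add_div, mul_div_cancel_left₀ _ hK0.ne', mul_div_assoc, sub_sub_cancel]
      rw [← e1, div_le_iff₀ hK0]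
      linarith only [hsum]
    have hcore := prodBernoulli_real_closedCount_ge_le_three_halves_leaf w F hF5 hs hpair hq0 hq1 hqs ht1 ht2
    -- the bad event off the null set ⊆ {spoke ℓ closed} ∪ ({spoke ℓ open} ∩ {t ≤ #closed})
    have hcont : {ω : BondConfig (Fin n) | 1 ≤ (A.filter fun a => ω ∈ openConn ℓ a).card ∧
        ((A.filter fun a => ω ∈ openConn ℓ a).card : ℝ) < κ * (∑ a ∈ A, (prodBernoulli w).real (openConn ℓ a))} ∩
        {ω : BondConfig (Fin n) | ∃ e, w e = 0 ∧ e ∈ ω}ᶜ ⊆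
        {ω : Set (Sym2 (Fin n)) | s(h, ℓ) ∉ ω} ∪
          ({ω : Set (Sym2 (Fin n)) | s(h, ℓ) ∈ ω} ∩ {ω : Set (Sym2 (Fin n)) | t ≤ (F.filter fun e => e ∉ ω).card}) := by
      rintro ω ⟨⟨-, hlt⟩, hz⟩
      have hω : ∀ e, w e = 0 → e ∉ ω := fun e he heω => hz ⟨e, he, heω⟩
      by_cases hX : s(h, ℓ) ∈ ω
      · right
        refine ⟨hX, ?_⟩
        show t ≤ (F.filter fun e => e ∉ ω).card
        rw [hFfilter ω, ht]
        rw [Star.card_filter_openConn_leaf_open hw hω hℓ hX A, if_pos hℓA, ← hA''] at hlt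
        have hL : r < ((A''.filter fun a => s(h, a) ∉ ω).card : ℝ) := by
          rw [hr]; linarith only [hlt, h23, hIh.1, hsplit ω]
        have hfl : ⌊r⌋₊ < (A''.filter fun a => s(h, a) ∉ ω).card := (Nat.floor_lt hr0).2 hL
        omega
      · left; exact hX
    refine (measureReal_le_of_inter_compl_subset (SpiderGluing.real_exists_zero_open w) hcont).trans ?_
    refine (measureReal_union_le _ _).trans ?_
    have hℓF : Disjoint ({s(h, ℓ)} : Finset (Sym2 (Fin n))) F := by
      rw [Finset.disjoint_singleton_left, hF]
      intro hmem
      obtain ⟨a, ha, hea⟩ := Finset.mem_image.1 hmem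
      have : a = ℓ := Sym2.congr_right.1 hea
      exact (Finset.ne_of_mem_erase (Finset.mem_of_mem_erase ha)) this
    have hind : (prodBernoulli w).real ({ω : Set (Sym2 (Fin n)) | s(h, ℓ) ∈ ω} ∩
        {ω : Set (Sym2 (Fin n)) | t ≤ (F.filter fun e => e ∉ ω).card}) =
        (prodBernoulli w).real {ω : Set (Sym2 (Fin n)) | s(h, ℓ) ∈ ω} *
          (prodBernoulli w).real {ω : Set (Sym2 (Fin n)) | t ≤ (F.filter fun e => e ∉ ω).card} :=
      prodBernoulli_real_inter_of_determinedBy_disjoint w hℓF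
        (Literature.Combinatorics.Sahi2008.Kahn2022.determinedBy_setOf_mem _) (determinedBy_closedCount_ge F t)
        MeasurableSet.of_discrete MeasurableSet.of_discrete
    rw [hind, prodBernoulli_real_setOf_notMem, prodBernoulli_real_setOf_mem]
    rw [sub_sub_cancel] at hcore
    exact hcore
  · -- observer is a non-relay leaf: `1 ≤ N` forces its spoke open; plain threshold `t > K/3 + 2S/3`
    rw [if_neg hℓA] at h23
    obtain ⟨r, hr⟩ : ∃ r : ℝ, r = (A''.card : ℝ) / 3 + 2 * S / 3 := ⟨_, rfl⟩
    have hr0 : 0 ≤ r := by rw [hr]; linarith only [hS0, hK0]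
    obtain ⟨t, ht⟩ : ∃ t : ℕ, t = ⌊r⌋₊ + 1 := ⟨_, rfl⟩
    have htR : (t : ℝ) = ⌊r⌋₊ + 1 := by rw [ht]; push_cast; ring
    have ht1 : (F.card : ℝ) / 3 + 2 * (∑ e ∈ F, (1 - (w e : ℝ))) / 3 < t := by
      rw [hFcard, hFsum, htR, ← hr]; exact Nat.lt_floor_add_one r
    have ht2 : (t : ℝ) ≤ (F.card : ℝ) / 3 + 2 * (∑ e ∈ F, (1 - (w e : ℝ))) / 3 + 1 := by
      rw [hFcard, hFsum, htR]
      linarith only [Nat.floor_le hr0, hr]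
    have hcore := prodBernoulli_real_closedCount_ge_le_three_halves w F hF5 hs hpair ht1 ht2
    refine (measureReal_le_of_inter_compl_subset (SpiderGluing.real_exists_zero_open w) ?_).trans hcore
    rintro ω ⟨⟨h1, hlt⟩, hz⟩
    have hω : ∀ e, w e = 0 → e ∉ ω := fun e he heω => hz ⟨e, he, heω⟩
    show t ≤ (F.filter fun e => e ∉ ω).card
    rw [hFfilter ω, ht]
    by_cases hX : s(h, ℓ) ∈ ω
    · rw [Star.card_filter_openConn_leaf_open hw hω hℓ hX A, if_neg hℓA, ← hA''] at hlt
      have hL : r < ((A''.filter fun a => s(h, a) ∉ ω).card : ℝ) := by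
        rw [hr]; linarith only [hlt, h23, hIh.1, hsplit ω]
      have hfl : ⌊r⌋₊ < (A''.filter fun a => s(h, a) ∉ ω).card := (Nat.floor_lt hr0).2 hL
      omega
    · exfalso
      have h0 := Star.card_filter_openConn_leaf_closed hw hω hℓ hX A
      rw [if_neg hℓA] at h0
      have : (1 : ℝ) ≤ ((A.filter fun a => ω ∈ openConn ℓ a).card : ℝ) := by exact_mod_cast h1
      linarith

/-! ### All stars, all observers -/

/-- **(LT³⁄₂) ON ALL STARS** (the conjecture `Consts.LinearLowerTailThreeHalves` restricted to star-supported weights): for every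
`0 < κ ≤ 2/3`, every `n`, every weight function `w` on `Sym2 (Fin n)` vanishing off the spokes of a hub `h`, every relay set `A`,
every observer `o` and every `s ≥ 0` with `P(a ↮ a') ≤ s` for all `a, a' ∈ A`:  `P(1 ≤ N < κ·EN) ≤ (3/2)·s`.
[cite: KozmaNitzan2024, Conj. 1 (p. 3)] -/
theorem linearLowerTailThreeHalves_star :
    ∀ κ : ℝ, 0 < κ → κ ≤ 2 / 3 →
      ∀ (n : ℕ) (w : Sym2 (Fin n) → unitInterval) (h : Fin n), (∀ e, h ∉ e → w e = 0) →
      ∀ (A : Finset (Fin n)) (o : Fin n) (s : ℝ), 0 ≤ s →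
        (∀ a ∈ A, ∀ a' ∈ A, (prodBernoulli w).real (openConn a a')ᶜ ≤ s) →
        (prodBernoulli w).real {ω : BondConfig (Fin n) | 1 ≤ (A.filter fun a => ω ∈ openConn o a).card ∧
            ((A.filter fun a => ω ∈ openConn o a).card : ℝ) < κ * (∑ a ∈ A, (prodBernoulli w).real (openConn o a))} ≤
          3 / 2 * s := by
  intro κ hκ0 hκ n w h hw A o s hs hrel
  by_cases ho : o = h
  · subst ho
    exact real_lowerTail_le_three_halves_star_hub n w o hw A hκ0 hκ hs hrel
  · exact real_lowerTail_le_three_halves_star_leaf n w h hw A ho hκ0 hκ hs hrel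

end Consts

end Summit.CriticalPhenomena.PercolationContinuityZ3.Theorems
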